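import Summits.AtomisticToContinuum.HydrodynamicLimit.Theses.WarmColdCarving
import Literature.Analysis.FluidPDE.HardSphereAlexander
import Literature.MathematicalPhysics.KineticTheory.HardSphereEulerProofs

/-!
Refutation of `WarmColdCarving.ColdCellsNegligible` (item stmt-AtomisticToContinuum-6612).

Same degenerate instance as for `ColdIsRare`: the statement quantifies over ALL `ℓ, α > 0`; for
`ℓ = 1/2`, `α = 1` (so `α (4/3) π ℓ³ = π/6 ≤ 1`) the singleton sub-population `{i}` of the ball of `i`
witnesses "cold" for every particle in every configuration (zero empirical variance `≤ δ² θe`), so the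
time-averaged cold fraction is identically `1 > β = 1/2` (take `J = 0`, `s ≡ 0`), the event is the
whole phase space and its local-Gibbs probability is `1 > ε = 1/2` (`isProbabilityMeasure_localGibbsLaw`,
constant profiles, `σ ≤ 1/2`).  The flow instantiating `∀ Φ` is Alexander's
(`HardSphereFlow.nonempty_torus_holds`).  Fix for the planner: add the side condition
`3 < α * (4/3 * π * ℓ^3)` (any `≤ 3` velocities in `ℝ³` have a direction of zero variance).
-/

namespace Summit.AtomisticToContinuum.HydrodynamicLimit.Theorems

open MeasureTheory
open Literature.Analysis.FluidPDE Literature.MathematicalPhysics.KineticTheory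

/-- Refutes `WarmColdCarving.ColdCellsNegligible`: constant profiles, `θe = 1`, `ℓ = 1/2`, `α = 1`,
`β = ε = 1/2`, one instant `s₀ = 0`: every singleton sub-population is cold, the cold fraction is `1`,
and the local Gibbs law is a probability measure, so the bound `≤ 1/2` fails; witness flow from
Alexander's theorem. [folklore] -/
theorem WarmColdCarvingColdCellsNegligible_refuted :
    ¬ Summit.AtomisticToContinuum.HydrodynamicLimit.Theses.WarmColdCarving.ColdCellsNegligible := by
  intro h
  obtain ⟨σ₀, hσ₀, h1⟩ := h (fun _ => 1) (fun _ => 1) (fun _ => 0) continuous_const continuous_const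
    continuous_const (fun _ => one_pos) (fun _ => one_pos) 1 one_pos
  set σ : ℝ := min (σ₀ / 2) (1 / 4) with hσdef
  have hσpos : 0 < σ := lt_min (by linarith) (by norm_num)
  have hσlt : σ < σ₀ := lt_of_le_of_lt (min_le_left _ _) (by linarith)
  have hσle : σ ≤ 1 / 4 := min_le_right _ _
  obtain ⟨δ₀, hδ₀, h2⟩ := h1 σ hσpos hσlt (1 / 2) 1 (1 / 2) (1 / 2) (by norm_num) one_pos
    (by norm_num) (by norm_num)
  obtain ⟨N₀, h3⟩ := h2 δ₀ hδ₀ le_rfl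
  have hεpos : 0 < hsDiameter σ N₀ := hsDiameter_pos hσpos N₀
  have hεlt : hsDiameter σ N₀ < 2⁻¹ := by
    have := hsDiameter_le hσpos.le N₀
    linarith
  obtain ⟨Φ⟩ := HardSphereFlow.nonempty_torus_holds (d := Fin 3) hεpos hεlt (N₀ + 1)
  have h4 := h3 N₀ le_rfl Φ 0 fun _ => 0
  have key : ∀ {f : Fin (N₀ + 1) → ℝ} {b : ℝ}, b < 1 → (∀ i, f i = 1) →
      b < ((N₀ : ℝ) + 1)⁻¹ * ∑ i : Fin (N₀ + 1), f i := by
    intro f b hb hf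
    have hs : ∑ i : Fin (N₀ + 1), f i = (N₀ : ℝ) + 1 := by
      simp [hf]
    rw [hs, inv_mul_cancel₀ (by positivity)]
    exact hb
  haveI hprob : IsProbabilityMeasure
      (localGibbsLaw σ (fun _ => 1) (fun _ => 0) (fun _ => (1 : ℝ)) N₀ Φ) :=
    isProbabilityMeasure_localGibbsLaw continuous_const continuous_const continuous_const
      (fun _ => one_pos) (fun _ => one_pos) (by linarith) N₀ Φ
  have hle : (localGibbsLaw σ (fun _ => 1) (fun _ => 0) (fun _ => (1 : ℝ)) N₀ Φ) Set.univ
      ≤ ENNReal.ofReal (1 / 2) := by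
    refine le_trans (measure_mono fun z _ => ?_) h4
    simp only [Set.mem_setOf_eq, Nat.cast_zero, zero_add, inv_one, one_mul, Finset.range_one,
      Finset.sum_singleton]
    refine key (by norm_num) fun i => ?_
    refine if_pos ⟨{i}, ?_, ?_, ?_⟩
    · intro j hj
      rw [Finset.mem_singleton] at hj
      subst hj
      simp only [Finset.mem_filter, Finset.mem_univ, true_and, Torus.euclidDist_self]
      positivity
    · have hπ := Real.pi_le_four
      simp only [Finset.card_singleton, Nat.cast_one]
      nlinarith
    · refine ⟨EuclideanSpace.single 0 1, by simp, ?_⟩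
      simp only [Finset.sum_singleton, Finset.card_singleton, Nat.cast_one, inv_one, one_mul,
        sub_self]
      first
        | positivity
        | (norm_num; done)
        | (norm_num; positivity)
  have hlt : ENNReal.ofReal (1 / 2 : ℝ) < 1 := by
    rw [ENNReal.ofReal_lt_one]
    norm_num
  rw [measure_univ] at hle
  exact absurd (lt_of_le_of_lt hle hlt) (lt_irrefl 1)

end Summit.AtomisticToContinuum.HydrodynamicLimit.Theorems
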